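import Summits.BirchSwinnertonDyer.BirchSwinnertonDyer.Theorems.ClassRecordThreeEulerHalvesAtThreeWalkCebotarev
import Summits.BirchSwinnertonDyer.BirchSwinnertonDyer.Theorems.Rank1ResidualJetSelmerLemmas
import Summits.BirchSwinnertonDyer.BirchSwinnertonDyer.Theorems.Rank1ResidualJetGlobalDualityLocal
import HarnessLib

/-!
# Conductor bookkeeping of the Jetchev walk: the square-free multiples `c·∏ n` of a Kolyvagin
# conductor, carrier places versus Kolyvagin places, `𝓕₀ ≤ 𝓕`, and Lemma 6.1 with a FRESH prime
# (cell `bsd-stepL`, seat `bsd-stepL-tam3-p1`, helper toward item 19109 `EulerHalvesAtThree`,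
# registered stub `stub_jetchevMaxHLAtThree`)

HONEST FRAMING. Nothing here proves BSD, J₃ or any divisibility; the registered stub is NOT discharged;
no item closes; 0 classes move (T7); `--supports stmt-BirchSwinnertonDyer-19109` (helper). WHAT THIS
FILE DOES (bookkeeping for the instantiation `…EulerHalvesAtThreeWalkFamilies` of the kernel walk
`JET.Section6.tamagawaExponent_le_m_of_selmerFamilies`, p484791): `squarefree_mul_prod_facts` — for a
square-free `c` and a finite set `n` of (injectively labelled) primes not dividing `c`, the conductor
`c·∏_{ℓ∈n} ℓ` is square-free, has prime factors `primeFactors c ∪ n`, and is prime to every labelled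
prime outside `n` (the conductors `cn ∈ Λ` of [J] §3.1); `selmerGroup_selmerF0_le` —
`H_{𝓕₀(c)} ≤ H_{𝓕(c)}` when the stringent family lies under the Kummer condition and the carrier
places avoid `c` ([J] Lemma 3.4 ∕ §3.3.2); `exists_fresh_kolyvaginPrime_addOrderOf_localization_eq` —
the decoupled Lemma 6.1 (`…WalkCebotarev`, p494064) with the prime chosen OUTSIDE a given finite set
and prime to `c` (Čebotarev gives primes above any bound).
References (locators only; no cited FACT declared): [cite: Jetchev2008, §3.1 (p. 817), §3.3.2 and
Lemma 3.4 (p. 816), Lemma 5.1 (p. 821)] [cite: McCallumLMS1991, §3 Cor. 3.2].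
Design: theorems only; `K : Type`. Axioms: `propext`, `Classical.choice`, `Quot.sound`.
-/

set_option autoImplicit false

noncomputable section

open scoped Classical NumberField

namespace Summit.BirchSwinnertonDyer.Rank1Residual.JET.Walk

open WeierstrassCurve IsDedekindDomain NumberField Literature.NumberTheory.EllipticCurves
  Literature.NumberTheory.EllipticCurves.Jetchev2008 Literature.NumberTheory.GaloisRepresentations
  Literature.NumberTheory.GaloisRepresentations.DiscreteGaloisModule

/-! ### §1 The conductors `c·∏ n` -/

/-- **The conductors of the walk are admissible.** For `c` square-free and a finite set `n` of
labels with pairwise distinct prime values `f ℓ` not dividing `c`: `c·∏_{ℓ∈n} f ℓ` is square-free, its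
prime factors are those of `c` together with the `f ℓ`, `ℓ ∈ n`, and no `f ℓ` with `ℓ ∉ n` divides it.
(Induction on `n`.) [cite: Jetchev2008, §3.1 (p. 817): the set `Λ` of square-free products] -/
theorem squarefree_mul_prod_facts {P : Type*} (f : P → ℕ) (hf : Function.Injective f)
    (hprime : ∀ ℓ, (f ℓ).Prime) {c : ℕ} (hc : Squarefree c) (hfc : ∀ ℓ, ¬ f ℓ ∣ c) (n : Finset P) :
    Squarefree (c * ∏ ℓ ∈ n, f ℓ) ∧
      (c * ∏ ℓ ∈ n, f ℓ).primeFactors = c.primeFactors ∪ n.image f ∧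
      ∀ ℓ, ℓ ∉ n → ¬ f ℓ ∣ c * ∏ ℓ ∈ n, f ℓ := by
  induction n using Finset.induction_on with
  | empty =>
    simp only [Finset.prod_empty, mul_one, Finset.image_empty, Finset.union_empty]
    exact ⟨hc, trivial, fun ℓ _ ↦ hfc ℓ⟩
  | insert a s ha ih =>
    obtain ⟨hsq, hfac, hnd⟩ := ih
    have hs0 : c * ∏ ℓ ∈ s, f ℓ ≠ 0 := hsq.ne_zero
    have ha0 : f a ≠ 0 := (hprime a).ne_zero
    have hmul : c * ∏ ℓ ∈ insert a s, f ℓ = (c * ∏ ℓ ∈ s, f ℓ) * f a := by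
      rw [Finset.prod_insert ha]; ring
    rw [hmul]
    refine ⟨?_, ?_, ?_⟩
    · rw [Nat.squarefree_mul_iff]
      exact ⟨((Nat.Prime.coprime_iff_not_dvd (hprime a)).mpr (hnd a ha)).symm, hsq,
        (hprime a).prime.squarefree⟩
    · rw [Nat.primeFactors_mul hs0 ha0, hfac, (hprime a).primeFactors, Finset.image_insert,
        Finset.union_insert, Finset.insert_eq]
      ac_rfl
    · intro ℓ hℓ hdiv
      rw [Finset.mem_insert, not_or] at hℓ
      rcases (Nat.Prime.dvd_mul (hprime ℓ)).mp hdiv with h | h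
      · exact hnd ℓ hℓ.2 h
      · exact hℓ.1 (hf ((Nat.prime_dvd_prime_iff_eq (hprime ℓ) (hprime a)).mp h))

variable {K : Type} [Field K] [NumberField K]

/-! ### §2 `H_{𝓕₀(c)} ≤ H_{𝓕(c)}` -/

/-- **`𝓕₀(c) ≤ 𝓕(c)` on Selmer groups** when the stringent family lies under the Kummer condition
(`𝒮 ≤` Kummer, printed: the image of `E⁰(K_v) ⊆ E(K_v)`) and the carrier places `Q` avoid the places
`S` modified by `c`. [cite: Jetchev2008, §3.3.2 and Lemma 3.4 (p. 816)] -/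
theorem selmerGroup_selmerF0_le (W : WeierstrassCurve ℚ) (n : ℤ)
    (𝒯 𝒮 : SelmerStructure ((W.baseChange K).torsionGaloisModule n))
    (hS : ∀ v, 𝒮 v ≤ (W.baseChange K).kummerSelmerStructure n v)
    {S Q : Finset (HeightOneSpectrum (𝓞 K))} (hQ : ∀ v ∈ Q, v ∉ S) :
    (selmerF0 W n 𝒯 𝒮 S Q).selmerGroup ≤ (selmerF W n 𝒯 S).selmerGroup := by
  refine GlobalDuality.selmerGroup_mono fun v ↦ ?_
  rcases v with w | v
  · exact le_of_eq (SelmerVocabulary.selmerF0_inl W _ 𝒯 𝒮 _ _ w)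
  · rw [SelmerVocabulary.selmerF0_inr]
    split_ifs with hv
    · rw [SelmerVocabulary.selmerF_inr, if_neg (hQ v hv)]
      exact hS _
    · exact le_rfl

/-! ### §3 Lemma 6.1 with a fresh prime -/

/-- **[J] Lemma 6.1, decoupled, with the prime FRESH**: as
`Koly.exists_kolyvaginPrime_addOrderOf_localization_eq_shift` (level `p^k`, index `≥ k + j`, orders of
`x ∈ H^{e}` and `y ≠ 0 ∈ H^{−e}` preserved at `λ`), with `ℓ` moreover outside a given finite set `S` of
primes and prime to a given `c ≠ 0` (choose the bound above `c` and above `S`).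
[cite: Jetchev2008, Lemma 5.1 (p. 821)] [cite: McCallumLMS1991, §3 Cor. 3.2 (p. 299)] -/
theorem exists_fresh_kolyvaginPrime_addOrderOf_localization_eq
    (W : WeierstrassCurve ℚ) [W.IsElliptic] [W.IsGloballyMinimal] [NeZero (W.conductorNorm ℤ)]
    (hK : IsImaginaryQuadratic K) {p : ℕ} [Fact p.Prime] (hp2 : p ≠ 2)
    (hρ : W.HasSurjectiveModNGaloisRep p) (τ : K ≃ₐ[ℚ] K) (hτ : τ ≠ 1) {k : ℕ} (hk : 1 ≤ k) (j : ℕ)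
    {e : ℤ} (he : e = 1 ∨ e = -1)
    (x y : galH1Torsion (W.baseChange K) ((p ^ k : ℕ) : ℤ))
    (hx : conjAct W τ ((p ^ k : ℕ) : ℤ) x = e • x) (hy : conjAct W τ ((p ^ k : ℕ) : ℤ) y = (-e) • y)
    (hy0 : y ≠ 0) (S : Finset ℕ) {c : ℕ} (hc : c ≠ 0) :
    ∃ ℓ : ℕ, ℓ ∉ S ∧ ¬ ℓ ∣ c ∧ Zhang2014.IsKolyvaginPrime (W.conductorNorm ℤ) W K p ℓ ∧
      k + j ≤ Zhang2014.kolyvaginIndex W p ℓ ∧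
      ∀ v : HeightOneSpectrum (𝓞 K), (ℓ : 𝓞 K) ∈ v.asIdeal →
        addOrderOf (galoisCohomology.localization
            ((W.baseChange K).torsionGaloisModule ((p ^ k : ℕ) : ℤ)) (Sum.inr v) 1 x) = addOrderOf x ∧
        addOrderOf (galoisCohomology.localization
            ((W.baseChange K).torsionGaloisModule ((p ^ k : ℕ) : ℤ)) (Sum.inr v) 1 y) = addOrderOf y := by
  obtain ⟨ℓ, hbℓ, hZ, hidx, hord⟩ :=
    X11b.Three.Koly.exists_kolyvaginPrime_addOrderOf_localization_eq_shift W hK hp2 hρ τ hτ hk j he x y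
      hx hy hy0 (c + S.sum id)
  refine ⟨ℓ, fun hmem ↦ ?_, fun hdvd ↦ ?_, hZ, hidx, hord⟩
  · have : ℓ ≤ S.sum id := Finset.single_le_sum (f := id) (fun _ _ ↦ Nat.zero_le _) hmem
    omega
  · have := Nat.le_of_dvd (Nat.pos_of_ne_zero hc) hdvd
    omega

end Summit.BirchSwinnertonDyer.Rank1Residual.JET.Walk

end
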